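import Literature.NumberTheory.LFunctions.FordProgram1
import Literature.NumberTheory.LFunctions.FordLemma34
import HarnessLib

/-!
# PROGRAM 1 of Ford (2002), unconditional soundness

Topic `Literature/NumberTheory/LFunctions`. Everything here is PROVED (no new definitions, no
named facts).

`FordProgram1.lean` proves the soundness of Ford's PROGRAM 1 (`FordP1.row_of_checkK`) under the
hypothesis that Lemma 3.4 of the paper holds at `k` for every `ω ∈ [1/(3 log k), 1/2]`
(`FordP1.Lemma34Hyp k ω`). Lemma 3.4 is now a theorem of the tree for `k ≥ 128` and
`1/20 ≤ ω ≤ 1/2` (`FordVK.lemma34Hyp_of`, `FordLemma34.lean`; the restriction `ω ≥ 1/20` is that of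
the prime windows of `FordPrimeWindowsPNT.lean`). The program only ever uses Lemma 3.4 at its own
`ω = omN/omD`, and the tabulated `ω` of Theorem 3 (`FordP1.omOf`: `0.0745, 0.0727, 0.0694`) are
`≥ 1/20`; so the soundness statements become unconditional:

* `FordP1.row_of_checkK_uncond` — `checkK k omN omD rhoN thetaN = true` and `omD ≤ 20·omN` give the row
  `∃ s ≤ ρk², J_{s,k}(P) ≤ k^{θk³} P^{2s − k(k+1)/2 + k²/1000}`;
* `FordP1.row_of_checkT_uncond` — the same for the tabulated check `checkT k`.

## References

* K. Ford, Proc. London Math. Soc. (3) 85 (2002), 565–633; arXiv:1910.08209: Theorem 3 (second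
  part) and its proof, PROGRAM 1 (Appendix), Lemma 3.4. [Ford2002]
-/

namespace Literature.NumberTheory.LFunctions
namespace FordP1

open Finset Real

/-- **Soundness of PROGRAM 1 for one `k`, unconditional**: if `checkK k omN omD rhoN thetaN = true`
and `omD ≤ 20 omN` (i.e. `ω = omN/omD ≥ 1/20`), then
`∃ s ≤ ρk², J_{s,k}(P) ≤ k^{θk³} P^{2s − k(k+1)/2 + k²/1000}` (`P ≥ 1`), `ρ = rhoN/10⁵`, `θ = thetaN/10⁴`.
(Proof: that of `FordP1.row_of_checkK`, with Lemma 3.4 supplied by `FordVK.lemma34Hyp_of`.)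
[cite: Ford2002, Theorem 3 (second part) and its proof] -/
theorem row_of_checkK_uncond {k omN omD rhoN thetaN : ℕ} (h : checkK k omN omD rhoN thetaN = true)
    (h20 : omD ≤ 20 * omN) :
    ∃ s : ℕ, 1 ≤ s ∧ (s : ℝ) ≤ (rhoN : ℝ) / 100000 * (k : ℝ) ^ 2 ∧
      ∀ P : ℕ, 1 ≤ P → (VMV.J k s (Finset.Icc (1 : ℤ) P) : ℝ) ≤
        (k : ℝ) ^ ((thetaN : ℝ) / 10000 * (k : ℝ) ^ 3) *
          (P : ℝ) ^ ((2 * (s : ℝ)) - ((k * (k + 1) / 2 : ℕ) : ℝ) + 0.001 * (k : ℝ) ^ 2) := by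
  have hS : (0 : ℝ) < Sc := by exact_mod_cast Sc_pos
  unfold checkK at h
  cases hld : logData k omN omD with
  | none => simp [hld] at h
  | some tup =>
  obtain ⟨lkhi, lklo, lk1hi, letahi, lVhi⟩ := tup
  simp only [hld, Bool.and_eq_true, Nat.ble_eq] at h
  obtain ⟨⟨⟨⟨homN, hom2⟩, _⟩, hk⟩, hrun⟩ := h
  cases hr : run k lkhi letahi lVhi (4 * k) (initSt k lk1hi) with
  | none => simp [hr] at hrun
  | some st =>
  simp only [hr, Bool.and_eq_true, Nat.ble_eq] at hrun
  obtain ⟨⟨hs1, hsrho⟩, hLth⟩ := hrun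
  have homD : 0 < omD := by omega
  obtain ⟨hlk, hlklo, hlk1, hleta, hlV⟩ := logData_sound (by omega) homN homD hld
  set ω : ℝ := (omN : ℝ) / omD with hω
  have hω0 : 0 < ω := by positivity
  have hkr : (129 : ℝ) ≤ k := by exact_mod_cast hk
  have hlogk : 0 < Real.log k := Real.log_pos (by linarith)
  -- `ω` is admissible for `FordVK.lemma34Hyp_of`
  have hω1 : 1 / 20 ≤ ω := by
    rw [hω, div_le_div_iff₀ (by norm_num) (by positivity), one_mul]
    have : ((omD : ℕ) : ℝ) ≤ ((20 * omN : ℕ) : ℝ) := by exact_mod_cast h20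
    push_cast at this; linarith
  have hω2 : ω ≤ 1 / 2 := by
    rw [hω, div_le_div_iff₀ (by positivity) (by norm_num)]
    have : ((2 * omN : ℕ) : ℝ) ≤ omD := by exact_mod_cast hom2
    push_cast at this; linarith
  have hL34 : Lemma34Hyp k ω := FordVK.lemma34Hyp_of (le_trans (by norm_num) hk) hω1 hω2
  -- the run
  have hI := run_sound hk hω0 hlk hleta hlV hL34 (4 * k) (Or.inl ⟨rfl, init_sound hk hlk1⟩) hr
  rcases hI with ⟨hs0, _⟩ | ⟨_, hs, hJ⟩
  · exfalso; omega
  refine ⟨st.s, hs, ?_, fun P hP => ?_⟩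
  · have : ((st.s * 100000 : ℕ) : ℝ) ≤ ((rhoN * (k * k) : ℕ) : ℝ) := by exact_mod_cast hsrho
    push_cast at this
    rw [div_mul_eq_mul_div, le_div_iff₀ (by norm_num : (0:ℝ) < 100000)]
    nlinarith
  · refine (hJ P hP).trans (mul_le_mul_of_nonneg_right ?_ (by positivity))
    -- `exp(L/Sc) ≤ k^{θ k³}`
    have h1 : ((st.Lnum * 10000 : ℕ) : ℝ) ≤ ((thetaN * k ^ 3 * lklo : ℕ) : ℝ) := by exact_mod_cast hLth
    push_cast at h1
    have h2 : (lklo : ℝ) ≤ Real.log k * Sc := by rwa [div_le_iff₀ hS] at hlklo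
    rw [Real.rpow_def_of_pos (by linarith), Real.exp_le_exp, div_le_iff₀ hS]
    have h3 : (thetaN : ℝ) * (k : ℝ) ^ 3 * lklo ≤ (thetaN : ℝ) * (k : ℝ) ^ 3 * (Real.log k * Sc) :=
      mul_le_mul_of_nonneg_left h2 (by positivity)
    nlinarith

/-- `omOf k ≥ 694`, so `ω = omOf k / 10⁴ ≥ 1/20`. [cite: Ford2002, proof of Theorem 3 (definition of `ω`)] -/
theorem omOf_ge (k : ℕ) : 10000 ≤ 20 * omOf k := by
  unfold omOf; split_ifs <;> norm_num

/-- **Soundness of the tabulated check, unconditional**: `checkT k = true` gives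
`∃ s ≤ ρ_k k², J_{s,k}(P) ≤ k^{θ_k k³} P^{2s − k(k+1)/2 + k²/1000}` with `(ρ_k, θ_k)` the constants of
`FordP1.rhoOf`, `FordP1.thetaOf` (`(3.22313, 2.4191)`, `(3.21734, 2.3856)`, `(3.21432, 2.3296)`).
[cite: Ford2002, Theorem 3 (second part), (1.7)] -/
theorem row_of_checkT_uncond {k : ℕ} (h : checkT k = true) :
    ∃ s : ℕ, 1 ≤ s ∧ (s : ℝ) ≤ (rhoOf k : ℝ) / 100000 * (k : ℝ) ^ 2 ∧
      ∀ P : ℕ, 1 ≤ P → (VMV.J k s (Finset.Icc (1 : ℤ) P) : ℝ) ≤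
        (k : ℝ) ^ ((thetaOf k : ℝ) / 10000 * (k : ℝ) ^ 3) *
          (P : ℝ) ^ ((2 * (s : ℝ)) - ((k * (k + 1) / 2 : ℕ) : ℝ) + 0.001 * (k : ℝ) ^ 2) :=
  row_of_checkK_uncond h (omOf_ge k)

end FordP1
end Literature.NumberTheory.LFunctions
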